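import Summits.BirchSwinnertonDyer.BirchSwinnertonDyer.Theorems.EisensteinDepletionAtTwoStarOptBSFShimuraExponent
import Literature.NumberTheory.EllipticCurves.ShimuraSubgroupHeckeCongruence
import HarnessLib

/-!
# Line `star` on crux E1M (stmt-BirchSwinnertonDyer-20341), even-index residue: the Shimura-exponent door from ONE prime of the level
# (Ling–Oesterlé: `U_p = p` on `Σ(N)`, tree `heckeEigenPeriodCongruence_holds`: `(a_p − p)·Λ_f ⊆ Λ₁(f)`)

Lead star-p1 GEN 16, third door instance.  The tree's Ling–Oesterlé congruence (Literature/…/ShimuraSubgroupHeckeCongruence,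
`heckeEigenPeriodCongruence_holds`: for `f ∈ S₂(Γ₀(N))`, `p ∣ N` prime, `T_p f = a f` ⇒ `(a − p)·Λ_f ⊆ Λ₁(f)`) gives the Shimura-exponent
hypothesis «`2d·Λ_f ⊆ Λ₁(f)`, `d` odd» of `SfShimuraExp.starOptBSF_of_shimuraExpTwo_of_T1` CLASS BY CLASS: it suffices that ONE prime `p ∣ N` has
`v₂(p − a_p) = 1`, i.e. `p ≡ 3 (mod 4)` and `a_p = +1` (split multiplicative) or `p ≡ 1 (mod 4)` and `a_p = −1` (non-split).  So GEN 15's second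
position law (T2) is needed only for habitat classes with `a_p ≡ p (mod 4)` at EVERY `p ∣ N`.  Census (memo Lines/star-even-structure-gen16.md): in all
22 habitat even-index classes at `p ≡ q ≡ 3 (mod 4)` levels one prime is split and the other non-split; the classes outside every door are 15a (excluded),
39a, 55a and the MID-pointed non-habitat centres.

* `exists_odd_two_mul_nsmul_mem_periodLatticeGamma1_of_hecke` — `T_p`-eigenvalue `a ∈ ℤ` at `p ∣ N` with `p − a = ±2d`, `d` odd ⇒ `2d·Λ_f ⊆ Λ₁(f)`;
* `starOptBSF_of_splitPrime3_of_T1` (`p ≡ 3 (mod 4)`, `a_p(W) = 1`), `starOptBSF_of_nonsplitPrime1_of_T1` (`p ≡ 1 (mod 4)`, `a_p(W) = −1`) —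
  the door from the prints + (T1) for habitat classes with such a prime.
CONDITIONAL on the prints and (T1); no `sorry`, no new definition; nothing here reads `r_an`; StarOptB / E1M / BSD are NOT proved by this file.
-/

set_option linter.dupNamespace false
set_option autoImplicit false

noncomputable section

open scoped Classical
open CongruenceSubgroup
open WeierstrassCurve Literature.NumberTheory.EllipticCurves Literature.NumberTheory.EllipticCurves.Greenberg1999
open Literature.NumberTheory.EllipticCurves.ModularForms
open Summit.BirchSwinnertonDyer.BirchSwinnertonDyer.Theorems.DepletionAtTwo

namespace Summit.BirchSwinnertonDyer.BirchSwinnertonDyer.Theorems.DepletionAtTwo.SfShimuraExp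

/-- **One prime with `p − a_p = ±2·odd` bounds the Shimura exponent.**  For a newform `f ∈ S₂(Γ₀(N))` (`IsNewform0`), a prime `p ∣ N` with
`a_p(f) = a ∈ ℤ` and `p − a = ±2d`, `d` odd: `2d·Λ_f ⊆ Λ₁(f)` (Ling–Oesterlé `U_p = p` on `Σ(N)`, tree `heckeEigenPeriodCongruence_holds`).
[cite: LingOesterle1991, Thm. 6] -/
theorem exists_odd_two_mul_nsmul_mem_periodLatticeGamma1_of_hecke {N : ℕ} [NeZero N] (f : CuspForm (Gamma0 N) 2) (hf : IsNewform0 f)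
    {p : ℕ} (hp : p.Prime) (hpN : p ∣ N) {a : ℤ} (ha : cuspCoeff f p = (a : ℂ)) {d : ℕ} (hd : Odd d)
    (h : (p : ℤ) - a = 2 * d ∨ (p : ℤ) - a = -(2 * d)) :
    ∃ d : ℕ, Odd d ∧ ∀ w ∈ periodLattice f, ((2 * d : ℕ) : ℂ) * w ∈ periodLatticeGamma1 f := by
  haveI : NeZero p := ⟨hp.ne_zero⟩
  have hT : heckeT (Gamma0 N) 2 p f = (a : ℂ) • f := by
    have h1 : heckeT (Gamma0 N) 2 p f = cuspCoeff f p • f := hf.heckeT_eq_coeff_smul hp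
    rw [h1, ha]
  refine ⟨d, hd, fun w hw ↦ ?_⟩
  have hc := heckeEigenPeriodCongruence_holds N p f (a : ℂ) hp hpN hT w hw
  rcases h with h | h
  · have e : ((2 * d : ℕ) : ℂ) * w = -(((a : ℂ) - p) * w) := by
      have : ((2 * d : ℕ) : ℂ) = ((p : ℤ) : ℂ) - (a : ℂ) := by exact_mod_cast h.symm
      rw [this]; push_cast; ring
    rw [e]; exact neg_mem hc
  · have e : ((2 * d : ℕ) : ℂ) * w = ((a : ℂ) - p) * w := by
      have : ((2 * d : ℕ) : ℂ) = (a : ℂ) - ((p : ℤ) : ℂ) := by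
        have h' : (a : ℤ) - p = 2 * d := by linarith
        exact_mod_cast h'.symm
      rw [this]; push_cast; ring
    rw [e]; exact hc

/-- **The door from a SPLIT prime `p ≡ 3 (mod 4)`** (`a_p(W) = 1`, `p − 1 = 2·odd`): prints + (T1) ⇒ the stub's conclusion for a habitat class whose
newform has such a prime in its level. [cite: LingOesterle1991, Thm. 6] [cite: Stevens1989, §2] [cite: GreenbergLNM1716, §5 Props. 5.13–5.14] -/
theorem starOptBSF_of_splitPrime3_of_T1 (hnf : exists_isNewformOf) (hex : exists_optimal_gamma1ParametrizationData)
    (hU : Literature.NumberTheory.Automorphic.CalegariDimitrovTang2025_unboundedDenominators) :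
    ∀ (W : WeierstrassCurve ℚ) [W.IsElliptic] [W.IsGloballyMinimal] (x : ℚ), IsOrdinaryAt W 2 →
      HasUniqueRationalTwoTorsionX W x →
      ((TwoTorsionRamifiedAtTwo x ∧ ¬ TwoTorsionOdd W x) ∨ (TwoTorsionOdd W x ∧ ¬ TwoTorsionRamifiedAtTwo x)) →
      ∀ ⦃N : ℕ⦄ [NeZero N] (f : CuspForm (Gamma0 N) 2), IsNewformOf W f →
      ∀ (p : ℕ), p.Prime → p ∣ N → p % 4 = 3 → W.LFunction p = 1 →
      ∀ (W₀ : WeierstrassCurve ℚ) [W₀.IsElliptic] [W₀.IsGloballyMinimal], IsNewformOf W₀ f →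
      ∀ (L₀ : PeriodPair), IsNeronLatticeOf (W₀.baseChange ℂ) L₀ → ∀ (q : ℚ), q ≠ 0 →
      (∀ z ∈ periodLattice f, (q : ℂ) * z ∈ L₀.lattice) → (∀ z ∈ L₀.lattice, ∃ w ∈ periodLattice f, z = (q : ℂ) * w) →
      (∀ x₀ : ℚ, HasUniqueRationalTwoTorsionX W₀ x₀ → TwoTorsionRamifiedAtTwo x₀ → TwoTorsionOdd W₀ x₀) →
      ∃ x₀ : ℚ, HasRationalTwoTorsionX W₀ x₀ ∧ TwoTorsionOdd W₀ x₀ ∧ ¬ TwoTorsionRamifiedAtTwo x₀ := by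
  intro W _ _ x hord hux htype N _ f hW p hp hpN hp4 hap W₀ _ _ hW₀ L₀ hL₀ q hq hin hout hT1
  have ha : cuspCoeff f p = ((1 : ℤ) : ℂ) := by rw [hW.2 p, hap]
  have hd : Odd ((p - 1) / 2) := by rw [Nat.odd_iff]; omega
  have h2 : (p : ℤ) - 1 = 2 * (((p - 1) / 2 : ℕ) : ℤ) := by omega
  exact starOptBSF_of_shimuraExpTwo_of_T1 hnf hex hU W x hord hux htype f hW
    (exists_odd_two_mul_nsmul_mem_periodLatticeGamma1_of_hecke f hW.1 hp hpN ha hd (Or.inl h2)) W₀ hW₀ L₀ hL₀ q hq hin hout hT1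

/-- **The door from a NON-SPLIT prime `p ≡ 1 (mod 4)`** (`a_p(W) = −1`, `p + 1 = 2·odd`): prints + (T1) ⇒ the stub's conclusion for a habitat class
whose newform has such a prime in its level. [cite: LingOesterle1991, Thm. 6] [cite: Stevens1989, §2] [cite: GreenbergLNM1716, §5 Props. 5.13–5.14] -/
theorem starOptBSF_of_nonsplitPrime1_of_T1 (hnf : exists_isNewformOf) (hex : exists_optimal_gamma1ParametrizationData)
    (hU : Literature.NumberTheory.Automorphic.CalegariDimitrovTang2025_unboundedDenominators) :
    ∀ (W : WeierstrassCurve ℚ) [W.IsElliptic] [W.IsGloballyMinimal] (x : ℚ), IsOrdinaryAt W 2 →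
      HasUniqueRationalTwoTorsionX W x →
      ((TwoTorsionRamifiedAtTwo x ∧ ¬ TwoTorsionOdd W x) ∨ (TwoTorsionOdd W x ∧ ¬ TwoTorsionRamifiedAtTwo x)) →
      ∀ ⦃N : ℕ⦄ [NeZero N] (f : CuspForm (Gamma0 N) 2), IsNewformOf W f →
      ∀ (p : ℕ), p.Prime → p ∣ N → p % 4 = 1 → W.LFunction p = -1 →
      ∀ (W₀ : WeierstrassCurve ℚ) [W₀.IsElliptic] [W₀.IsGloballyMinimal], IsNewformOf W₀ f →
      ∀ (L₀ : PeriodPair), IsNeronLatticeOf (W₀.baseChange ℂ) L₀ → ∀ (q : ℚ), q ≠ 0 →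
      (∀ z ∈ periodLattice f, (q : ℂ) * z ∈ L₀.lattice) → (∀ z ∈ L₀.lattice, ∃ w ∈ periodLattice f, z = (q : ℂ) * w) →
      (∀ x₀ : ℚ, HasUniqueRationalTwoTorsionX W₀ x₀ → TwoTorsionRamifiedAtTwo x₀ → TwoTorsionOdd W₀ x₀) →
      ∃ x₀ : ℚ, HasRationalTwoTorsionX W₀ x₀ ∧ TwoTorsionOdd W₀ x₀ ∧ ¬ TwoTorsionRamifiedAtTwo x₀ := by
  intro W _ _ x hord hux htype N _ f hW p hp hpN hp4 hap W₀ _ _ hW₀ L₀ hL₀ q hq hin hout hT1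
  have ha : cuspCoeff f p = ((-1 : ℤ) : ℂ) := by rw [hW.2 p, hap]
  have hd : Odd ((p + 1) / 2) := by rw [Nat.odd_iff]; omega
  have h2 : (p : ℤ) - (-1) = 2 * (((p + 1) / 2 : ℕ) : ℤ) := by omega
  exact starOptBSF_of_shimuraExpTwo_of_T1 hnf hex hU W x hord hux htype f hW
    (exists_odd_two_mul_nsmul_mem_periodLatticeGamma1_of_hecke f hW.1 hp hpN ha hd (Or.inl h2)) W₀ hW₀ L₀ hL₀ q hq hin hout hT1

end Summit.BirchSwinnertonDyer.BirchSwinnertonDyer.Theorems.DepletionAtTwo.SfShimuraExp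

end
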